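import Summits.QuantumFields.GaugeBoot.DiagonalRPTorusBandMiddle
import HarnessLib

/-!
# The band integral, II: the rectangle integral is a ladder integral (gauge-boot, task L3(π), 6/7)

HONEST FRAMING (cell `pub-gaugeboot`, page 1 of every file): the venture produces certified bounds
on lattice expectations at stated coupling, gauge group, dimension and torus size; NOT a mass gap,
NOT a continuum limit, NOT a string tension; NOT Yang–Mills-summit-bearing (barriers
`FixedCouplingUltralocality`, `PerturbativeInvisibility`). This module computes the leading
strong-coupling coefficient used by the structural NEGATIVE result
`DiagonalRPTorusInnerHalfNegativeEvenSUN` (inner-half diagonal RP fails on even three-tori for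
`G ≅ SU(N)` at small coupling); it discharges nothing by itself.

## Content (torus `(ℤ/L)³`, vertical plane `pl = (a, 2)`, columns `B`, `M = B + e_a`,
`A = B + 2e_a`; any compact metrisable `G`, continuous `ρ`)

Two changes of variables preserving the product Haar measure `∏ dU`:
* `shearSet m E` — multiplying each link variable `U(e)`, `e ∈ E`, on the right by the variable
  `U(m e)` of another link `m e ∉ E` (`integral_comp_shearSet`: Fubini along `e` and right
  invariance of Haar measure, one link at a time);
* `colSwap A M` — exchanging the vertical link variables over two columns
  (`integral_comp_colSwap`: a permutation of the coordinates, `measurePreserving_piCongrLeft`).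
Shearing the rungs over `B` by the rungs over `M` and then exchanging the columns `A`, `M` turns
the ladder integrand of `(M, B)` into the rectangle integrand (`ladderIntegrand_transform`), so
**`rectIntegral_eq_ladderIntegral`**: `rectIntegral ρ pl B = ladderIntegral ρ pl B`, and with
`DiagonalRPTorusBandMiddle` and `DiagonalRPTorusPolyakovLadderValue`:
**`bandIntegral_eq`** `bandIntegral = c₁^L · I(M, B)` and **`bandIntegral_pos`** (`c₁, c₂ > 0`,
`N ≥ 1`, (R1), (R2)).

Elementary; no named fact.
-/

open MeasureTheory Complex Finset Function
open scoped ComplexOrder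

namespace Summit.QuantumFields.GaugeBoot

open Literature.MathematicalPhysics.QuantumFieldTheory
open Literature.MathematicalPhysics.QuantumFieldTheory.PlaquetteLowerBound (reTr charVariance)
open Literature.RepresentationTheory.CompactGroups

noncomputable section

namespace DiagRPSUN

open DiagRPThree DiagRPPolyakov

/-! ## Shearing link variables -/

section Shear

variable {ι : Type*} [Fintype ι] [DecidableEq ι] {G : Type*} [Group G] [TopologicalSpace G]
  [IsTopologicalGroup G] [CompactSpace G] [MeasurableSpace G] [BorelSpace G]
  [SecondCountableTopology G]

/-- The SHEAR of the coordinates in `E` by the coordinates `m e`: `U(e) ↦ U(e) · U(m e)` for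
`e ∈ E`, identity elsewhere. -/
def shearSet (m : ι → ι) (E : Finset ι) (U : ι → G) : ι → G :=
  fun e => if e ∈ E then U e * U (m e) else U e

omit [Fintype ι] [TopologicalSpace G] [IsTopologicalGroup G] [CompactSpace G] [MeasurableSpace G]
  [BorelSpace G] [SecondCountableTopology G] in
/-- The empty shear is the identity. -/
theorem shearSet_empty (m : ι → ι) (U : ι → G) : shearSet m ∅ U = U := by
  funext e; simp [shearSet]

omit [Fintype ι] [TopologicalSpace G] [IsTopologicalGroup G] [CompactSpace G] [MeasurableSpace G]
  [BorelSpace G] [SecondCountableTopology G] in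
/-- Adding one coordinate to a shear is a one-coordinate update of the smaller shear. -/
theorem shearSet_insert (m : ι → ι) {E : Finset ι} {e : ι} (he : e ∉ E) (hme : m e ∉ E)
    (hme' : m e ≠ e) (U : ι → G) :
    shearSet m (insert e E) U =
      update (shearSet m E U) e (shearSet m E U e * shearSet m E U (m e)) := by
  funext e'
  by_cases h : e' = e
  · subst h
    simp [shearSet, he, hme]
  · rw [update_of_ne h]
    simp [shearSet, h]

omit [Fintype ι] [IsTopologicalGroup G] [CompactSpace G] [MeasurableSpace G] [BorelSpace G]
  [SecondCountableTopology G] in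
/-- A shear is continuous. -/
theorem continuous_shearSet [ContinuousMul G] (m : ι → ι) (E : Finset ι) :
    Continuous (shearSet (G := G) m E) := by
  refine continuous_pi fun e => ?_
  unfold shearSet
  split_ifs
  · exact (continuous_apply _).mul (continuous_apply _)
  · exact continuous_apply _

/-- **One-coordinate shear preserves every integral**: `∫ F(U[e ↦ U(e) U(m)]) ∏ dU = ∫ F ∏ dU`
for `m ≠ e` and continuous `F` (Fubini along `e`, right invariance of Haar measure). -/
theorem integral_comp_update_mul (e m' : ι) (hme : m' ≠ e) {F : (ι → G) → ℝ} (hF : Continuous F) :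
    ∫ U, F (update U e (U e * U m')) ∂Measure.pi (fun _ : ι => haarProbability G) =
      ∫ U, F U ∂Measure.pi (fun _ : ι => haarProbability G) := by
  have hS : Continuous fun U : ι → G => update U e (U e * U m') := by
    refine continuous_pi fun i => ?_
    by_cases hi : i = e
    · subst hi
      simp only [update_self]
      exact (continuous_apply _).mul (continuous_apply _)
    · simp only [update_of_ne hi]
      exact continuous_apply _
  have hInt : ∀ {H : (ι → G) → ℝ}, Continuous H →
      Integrable H (Measure.pi fun _ : ι => haarProbability G) := fun {H} hH => by
    obtain ⟨C, hC⟩ := isCompact_univ.exists_bound_of_continuousOn hH.continuousOn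
    exact Integrable.of_bound hH.aestronglyMeasurable C (ae_of_all _ fun U => hC U (Set.mem_univ _))
  have hFS : Continuous fun U : ι → G => F (update U e (U e * U m')) := hF.comp hS
  rw [integral_pi_update (haarProbability G) e (F := fun U : ι → G => F (update U e (U e * U m')))
      (hInt hFS), integral_pi_update (haarProbability G) e (hInt hF)]
  refine integral_congr_ae (ae_of_all _ fun U => ?_)
  have hupd : ∀ s : G, update (update U e s) e (update U e s e * update U e s m') =
      update U e (s * U m') := fun s => by
    rw [update_self, update_of_ne hme, update_idem]
  simp only [hupd]
  exact integral_mul_right_eq_self (μ := haarProbability G) (fun s => F (update U e s)) (U m')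

/-- **Shears preserve every integral**: if no multiplier coordinate is sheared
(`m e ∉ E`, `m e ≠ e` for `e ∈ E`), then `∫ F ∘ shearSet m E ∏ dU = ∫ F ∏ dU` for continuous `F`. -/
theorem integral_comp_shearSet (m : ι → ι) (E : Finset ι) (hE : ∀ e ∈ E, m e ∉ E ∧ m e ≠ e)
    {F : (ι → G) → ℝ} (hF : Continuous F) :
    ∫ U, F (shearSet m E U) ∂Measure.pi (fun _ : ι => haarProbability G) =
      ∫ U, F U ∂Measure.pi (fun _ : ι => haarProbability G) := by
  induction E using Finset.induction_on generalizing F with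
  | empty => simp [shearSet_empty]
  | @insert e E he ih =>
    have hE' : ∀ e' ∈ E, m e' ∉ E ∧ m e' ≠ e' := fun e' he' =>
      ⟨fun h => (hE e' (mem_insert_of_mem he')).1 (mem_insert_of_mem h), (hE e' (mem_insert_of_mem he')).2⟩
    obtain ⟨hme, hme'⟩ := hE e (mem_insert_self e E)
    have hmeE : m e ∉ E := fun h => hme (mem_insert_of_mem h)
    simp_rw [shearSet_insert m he hmeE hme']
    have hcont : Continuous fun V : ι → G => F (update V e (V e * V (m e))) :=
      hF.comp (continuous_id.update e ((continuous_apply e).mul (continuous_apply (m e))))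
    rw [ih hE' (F := fun V : ι → G => F (update V e (V e * V (m e)))) hcont]
    exact integral_comp_update_mul e (m e) hme' hF

end Shear

/-! ## Exchanging two columns -/

section Swap

variable {L : ℕ} {G : Type*}

/-- The column of a site. -/
def cols (y : Site 3 L) : ZMod L × ZMod L := (y 0, y 1)

/-- `cols (vsite C z) = C`. -/
@[simp] theorem cols_vsite (C : ZMod L × ZMod L) (z : ZMod L) : cols (vsite C z) = C := rfl

/-- A site is the vertical site of its column at its height. -/
theorem vsite_cols (y : Site 3 L) : vsite (cols y) (y 2) = y :=
  (eq_vsite_iff.2 ⟨⟨rfl, rfl⟩, rfl⟩).symm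

/-- The COLUMN EXCHANGE of the vertical links over `A` and over `M` (identity on all other links). -/
def colSwap (A M : ZMod L × ZMod L) (e : Edge 3 L) : Edge 3 L :=
  if e.2 = 2 ∧ cols e.1 = A then (vsite M (e.1 2), 2)
  else if e.2 = 2 ∧ cols e.1 = M then (vsite A (e.1 2), 2) else e

/-- The column exchange on the vertical links over `A`. -/
theorem colSwap_vsite_left (A M : ZMod L × ZMod L) (z : ZMod L) :
    colSwap A M (vsite A z, 2) = (vsite M z, 2) := by
  simp [colSwap]

/-- The column exchange on the vertical links over `M`. -/
theorem colSwap_vsite_right {A M : ZMod L × ZMod L} (hAM : A ≠ M) (z : ZMod L) :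
    colSwap A M (vsite M z, 2) = (vsite A z, 2) := by
  simp [colSwap, hAM.symm]

/-- The column exchange fixes vertical links over other columns. -/
theorem colSwap_vsite_of_ne {A M C : ZMod L × ZMod L} (hCA : C ≠ A) (hCM : C ≠ M) (z : ZMod L) :
    colSwap A M (vsite C z, 2) = (vsite C z, 2) := by
  simp [colSwap, hCA, hCM]

/-- The column exchange fixes horizontal links. -/
theorem colSwap_of_ne_two (A M : ZMod L × ZMod L) {y : Site 3 L} {k : Fin 3} (hk : k ≠ 2) :
    colSwap A M (y, k) = (y, k) := by
  simp [colSwap, hk]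

/-- The column exchange is an involution. -/
theorem colSwap_involutive {A M : ZMod L × ZMod L} (hAM : A ≠ M) :
    Function.Involutive (colSwap A M : Edge 3 L → Edge 3 L) := by
  intro e
  obtain ⟨y, k⟩ := e
  by_cases hk : k = 2
  · subst hk
    by_cases hA : cols y = A
    · rw [← vsite_cols y, hA, colSwap_vsite_left, colSwap_vsite_right hAM]
    · by_cases hM : cols y = M
      · rw [← vsite_cols y, hM, colSwap_vsite_right hAM, colSwap_vsite_left]
      · rw [← vsite_cols y, colSwap_vsite_of_ne hA hM, colSwap_vsite_of_ne hA hM]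
  · rw [colSwap_of_ne_two A M hk, colSwap_of_ne_two A M hk]

variable [Group G] [TopologicalSpace G] [IsTopologicalGroup G] [CompactSpace G] [MeasurableSpace G]
  [BorelSpace G]

/-- **Exchanging two columns preserves every integral** (a permutation of the coordinates of the
product Haar measure). -/
theorem integral_comp_colSwap [NeZero L] {A M : ZMod L × ZMod L} (hAM : A ≠ M)
    (F : GaugeConfig 3 L G → ℝ) :
    ∫ U, F (fun e => U (colSwap A M e)) ∂Measure.pi (fun _ : Edge 3 L => haarProbability G) =
      ∫ U, F U ∂Measure.pi (fun _ : Edge 3 L => haarProbability G) := by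
  set σ : Equiv.Perm (Edge 3 L) := (colSwap_involutive (L := L) hAM).toPerm _ with hσ
  set T : (Edge 3 L → G) ≃ᵐ (Edge 3 L → G) := MeasurableEquiv.piCongrLeft (fun _ => G) σ with hT
  have hTapply : ∀ (U : Edge 3 L → G) (e : Edge 3 L), T U e = U (colSwap A M e) := fun U e => by
    have h := MeasurableEquiv.piCongrLeft_apply_apply (β := fun _ => G) σ U (σ.symm e)
    rw [Equiv.apply_symm_apply] at h
    rw [hT, h, hσ, Function.Involutive.toPerm_symm, Function.Involutive.coe_toPerm]
  have hTmp : MeasurePreserving T (Measure.pi fun _ : Edge 3 L => haarProbability G)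
      (Measure.pi fun _ : Edge 3 L => haarProbability G) :=
    measurePreserving_piCongrLeft (fun _ : Edge 3 L => haarProbability G) σ
  have hT' : ∀ U : Edge 3 L → G, (T U : Edge 3 L → G) = fun e => U (colSwap A M e) :=
    fun U => funext (hTapply U)
  have h := hTmp.integral_comp' F
  simp only [hT'] at h
  exact h

end Swap

/-! ## The rectangle integral is the ladder integral -/

section Value

variable {L : ℕ} [NeZero L] {N : ℕ} {G : Type*} [Group G] [TopologicalSpace G]
  [IsTopologicalGroup G] [CompactSpace G] [MeasurableSpace G] [BorelSpace G]
  [SecondCountableTopology G] (ρ : G →* Matrix (Fin N) (Fin N) ℂ)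
  (pl : {q : Fin 3 × Fin 3 // q.1 < q.2}) (B : ZMod L × ZMod L)

omit [NeZero L] [TopologicalSpace G] [IsTopologicalGroup G] [CompactSpace G] [MeasurableSpace G]
  [BorelSpace G] [SecondCountableTopology G] in
/-- Relabelling a vertical line holonomy from one column to another. -/
theorem lineHolonomy_relabel {U V : GaugeConfig 3 L G} {C D : ZMod L × ZMod L}
    (h : ∀ w : ZMod L, V (vsite C w, 2) = U (vsite D w, 2)) :
    ∀ (n : ℕ) (z : ZMod L), lineHolonomy V 2 n (vsite C z) = lineHolonomy U 2 n (vsite D z)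
  | 0, z => rfl
  | n + 1, z => by
    show V (vsite C z, 2) * lineHolonomy V 2 n ((vsite C z).shift 2) =
      U (vsite D z, 2) * lineHolonomy U 2 n ((vsite D z).shift 2)
    rw [h z, vsite_shift_two, vsite_shift_two, lineHolonomy_relabel h n (z + 1)]

/-- The rungs over `B` in the direction `a = pl.1.1`. -/
def rungSet : Finset (Edge 3 L) := univ.image fun z : ZMod L => (vsite B z, pl.1.1)

/-- The multiplier of a link: the parallel link one step on in its own direction. -/
def rungMul (e : Edge 3 L) : Edge 3 L := (e.1.shift e.2, e.2)

omit [NeZero L] in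
/-- The multiplier of a rung over `B` is the rung over `M = B + e_a`: not a rung over `B`. -/
theorem rungMul_not_mem (hL : 1 < L) (hpl : pl.1.2 = 2) [NeZero L] :
    ∀ e ∈ rungSet pl B, rungMul e ∉ rungSet pl B ∧ rungMul e ≠ e := by
  intro e he
  obtain ⟨z, -, rfl⟩ := mem_image.1 he
  have ha := fst_ne_two pl hpl
  have hMB : bump pl.1.1 B ≠ B := bump_ne_self hL ha B
  have hm : rungMul ((vsite B z, pl.1.1) : Edge 3 L) = (vsite (bump pl.1.1 B) z, pl.1.1) := by
    unfold rungMul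
    rw [vsite_shift_of_ne_two B z ha]
  rw [hm]
  refine ⟨fun h => ?_, fun h => hMB (vsite_eq_vsite_iff.1 (congrArg Prod.fst h)).1⟩
  obtain ⟨w, -, hw⟩ := mem_image.1 h
  exact hMB (vsite_eq_vsite_iff.1 (congrArg Prod.fst hw)).1.symm

/-- The combined change of variables: shear the rungs over `B` by the rungs over `M`, then read
through the column exchange `A ↔ M`. -/
def transform (U : GaugeConfig 3 L G) : GaugeConfig 3 L G :=
  fun e => shearSet rungMul (rungSet pl B) U (colSwap (bump pl.1.1 (bump pl.1.1 B)) (bump pl.1.1 B) e)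

omit [TopologicalSpace G] [IsTopologicalGroup G] [CompactSpace G] [MeasurableSpace G] [BorelSpace G]
  [SecondCountableTopology G] in
/-- **The ladder integrand at the transformed configuration is the rectangle integrand.** -/
theorem ladderIntegrand_transform (hL : 3 ≤ L) (hpl : pl.1.2 = 2) (U : GaugeConfig 3 L G) :
    polRe ρ 2 (transform pl B U) (vsite (bump pl.1.1 B) 0) * polRe ρ 2 (transform pl B U) (vsite B 0) *
        ∏ z : ZMod L, WilsonRP.plaqRe ρ (transform pl B U) (vsite B z, pl) =
      polRe ρ 2 U (vsite (bump pl.1.1 (bump pl.1.1 B)) 0) * polRe ρ 2 U (vsite B 0) *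
        ∏ z : ZMod L, reTr ρ (rectWord pl B z U) := by
  have hL1 : 1 < L := by omega
  have ha := fst_ne_two pl hpl
  set a := pl.1.1 with ha_def
  set M := bump a B with hM
  set A := bump a M with hA
  have hMB : M ≠ B := bump_ne_self hL1 ha B
  have hAM : A ≠ M := bump_ne_self hL1 ha M
  have hAB : A ≠ B := bump_bump_ne_self hL ha B
  -- values of the transformed configuration on the links that are read
  have hrung : ∀ (C : ZMod L × ZMod L) (w : ZMod L), ((vsite C w, a) : Edge 3 L) ∈ rungSet pl B ↔ C = B := by
    intro C w
    constructor
    · intro h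
      obtain ⟨w', -, hw⟩ := mem_image.1 h
      exact (vsite_eq_vsite_iff.1 (congrArg Prod.fst hw)).1.symm
    · rintro rfl
      exact mem_image.2 ⟨w, mem_univ _, rfl⟩
  have hvert : ∀ (C : ZMod L × ZMod L) (w : ZMod L), ((vsite C w, (2 : Fin 3)) : Edge 3 L) ∉ rungSet pl B := by
    intro C w h
    obtain ⟨w', -, hw⟩ := mem_image.1 h
    exact ha (congrArg Prod.snd hw)
  have hVM : ∀ w : ZMod L, transform pl B U (vsite M w, 2) = U (vsite A w, 2) := fun w => by
    unfold transform
    rw [← ha_def, ← hM, ← hA, colSwap_vsite_right hAM]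
    simp [shearSet, hvert]
  have hVB2 : ∀ w : ZMod L, transform pl B U (vsite B w, 2) = U (vsite B w, 2) := fun w => by
    unfold transform
    rw [← ha_def, ← hM, ← hA, colSwap_vsite_of_ne hAB.symm hMB.symm]
    simp [shearSet, hvert]
  have hVBa : ∀ w : ZMod L, transform pl B U (vsite B w, a) = U (vsite B w, a) * U (vsite M w, a) := fun w => by
    unfold transform
    rw [← ha_def, ← hM, ← hA, colSwap_of_ne_two A M ha]
    simp only [shearSet, (hrung B w).2 rfl, if_true, rungMul]
    rw [vsite_shift_of_ne_two B w ha]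
  -- the three factors
  have hPM : polRe ρ 2 (transform pl B U) (vsite M 0) = polRe ρ 2 U (vsite A 0) := by
    unfold polRe
    rw [lineHolonomy_relabel hVM L 0]
  have hPB : polRe ρ 2 (transform pl B U) (vsite B 0) = polRe ρ 2 U (vsite B 0) := by
    unfold polRe
    rw [lineHolonomy_relabel hVB2 L 0]
  have hplaq : ∀ z : ZMod L, WilsonRP.plaqRe ρ (transform pl B U) (vsite B z, pl) =
      reTr ρ (rectWord pl B z U) := fun z => by
    rw [plaqRe_rung ρ pl hpl B, ← ha_def, ← hM, hVBa, hVM, hVBa, hVB2]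
    unfold rectWord
    rw [← ha_def, ← hM, ← hA]
  rw [hPM, hPB]
  simp_rw [hplaq]

omit [SecondCountableTopology G] in
/-- **The rectangle integral is the ladder integral** `I(M, B)` (`L ≥ 3`). -/
theorem rectIntegral_eq_ladderIntegral [SecondCountableTopology G] (hρ : Continuous ρ) (hL : 3 ≤ L)
    (hpl : pl.1.2 = 2) : rectIntegral ρ pl B = ladderIntegral ρ pl B := by
  have hL1 : 1 < L := by omega
  have ha := fst_ne_two pl hpl
  have hAM : bump pl.1.1 (bump pl.1.1 B) ≠ bump pl.1.1 B := bump_ne_self hL1 ha _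
  -- the ladder integrand
  set LI : GaugeConfig 3 L G → ℝ := fun V => polRe ρ 2 V (vsite (bump pl.1.1 B) 0) *
    polRe ρ 2 V (vsite B 0) * ∏ z : ZMod L, WilsonRP.plaqRe ρ V (vsite B z, pl) with hLI
  have hLIc : Continuous LI := ((continuous_polRe ρ hρ 2 _).mul (continuous_polRe ρ hρ 2 _)).mul
    (continuous_finsetProd _ fun z _ => continuous_plaqRe ρ hρ _)
  -- `LI ∘ (· ∘ colSwap)` is continuous
  have hLIσ : Continuous fun W : GaugeConfig 3 L G =>
      LI (fun e => W (colSwap (bump pl.1.1 (bump pl.1.1 B)) (bump pl.1.1 B) e)) :=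
    hLIc.comp (continuous_pi fun e => continuous_apply _)
  calc rectIntegral ρ pl B
      = ∫ U, LI (transform pl B U) ∂Measure.pi (fun _ : Edge 3 L => haarProbability G) := by
        unfold rectIntegral
        exact integral_congr_ae (ae_of_all _ fun U => (ladderIntegrand_transform ρ pl B hL hpl U).symm)
    _ = ∫ U, LI (fun e => U (colSwap (bump pl.1.1 (bump pl.1.1 B)) (bump pl.1.1 B) e))
          ∂Measure.pi (fun _ : Edge 3 L => haarProbability G) :=
        integral_comp_shearSet rungMul (rungSet pl B) (rungMul_not_mem pl B hL1 hpl) hLIσ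
    _ = ∫ U, LI U ∂Measure.pi (fun _ : Edge 3 L => haarProbability G) :=
        integral_comp_colSwap hAM LI
    _ = ladderIntegral ρ pl B := rfl

/-- **The band integral**: `bandIntegral = c₁^L · c₁^{L-1} c₂ (V₀² + V₁²)` under (R1), (R2). -/
theorem bandIntegral_eq (hρ : Continuous ρ) (hL : 3 ≤ L) (hpl : pl.1.2 = 2) {c₁ c₂ : ℝ}
    (hR1 : ∀ x y : G, ∫ g, reTr ρ (x * g⁻¹) * reTr ρ (g * y) ∂haarProbability G =
      c₁ * reTr ρ (x * y))
    (hR2 : ∀ x y : G, ∫ g, reTr ρ (g * x * g⁻¹ * y) ∂haarProbability G =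
      c₂ * ((ρ x).trace * (ρ y).trace).re) :
    bandIntegral ρ pl B = c₁ ^ L * (c₁ ^ (L - 1) * (c₂ * (charVariance ρ ^ 2 + charMixed ρ ^ 2))) := by
  rw [bandIntegral_eq_pow_mul_rectIntegral ρ pl B hpl hρ hL hR1,
    rectIntegral_eq_ladderIntegral ρ pl B hρ hL hpl, ladderIntegral_eq ρ pl B hpl hρ (by omega) hR1 hR2]

/-- **The band integral is positive** when `c₁, c₂ > 0`, `N ≥ 1`. -/
theorem bandIntegral_pos (hρ : Continuous ρ) (hL : 3 ≤ L) (hpl : pl.1.2 = 2) (hN : 1 ≤ N)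
    {c₁ c₂ : ℝ} (hc₁ : 0 < c₁) (hc₂ : 0 < c₂)
    (hR1 : ∀ x y : G, ∫ g, reTr ρ (x * g⁻¹) * reTr ρ (g * y) ∂haarProbability G =
      c₁ * reTr ρ (x * y))
    (hR2 : ∀ x y : G, ∫ g, reTr ρ (g * x * g⁻¹ * y) ∂haarProbability G =
      c₂ * ((ρ x).trace * (ρ y).trace).re) :
    0 < bandIntegral ρ pl B := by
  rw [bandIntegral_eq_pow_mul_rectIntegral ρ pl B hpl hρ hL hR1,
    rectIntegral_eq_ladderIntegral ρ pl B hρ hL hpl]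
  exact mul_pos (pow_pos hc₁ L) (ladderIntegral_pos ρ pl B hpl hρ (by omega) hN hc₁ hc₂ hR1 hR2)

end Value

end DiagRPSUN

end

end Summit.QuantumFields.GaugeBoot
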